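import Summits.BirchSwinnertonDyer.BirchSwinnertonDyer.Theorems.PrintCf2SplitBadTwoLocalControlKernelDyadicEven
import Summits.BirchSwinnertonDyer.BirchSwinnertonDyer.Theorems.PrintCf2SplitBadTwoCMPrimaryDyadicValueFrame
import HarnessLib

/-!
# Crux `PrintCf2.SplitBadTwoRankOneOfFacts` (stmt-BirchSwinnertonDyer-20368), road α v10.3 — brick B15 file 12: (R-DYADIC) ON THE LAST KEY (0,7) from (C3-loc):
# `LK_{v̄} = 0` (`#LK_{v̄} = 1`) for `d = 2d'`, `d' ≡ 7 (mod 8)` — the local character has image in `{1, 3 mod 8}·(1 + 8ℤ₂)`, which misses `−1`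

Cell `bsd-print-cf2`, width seat `bsd-line-cf2-p1-w2` g9 (prover-bsd-line-cf2-p1-w2-g9-0); brick B15 (memo `Cruxes/SplitBadTwoRankOneOfFacts/B15-DYADIC-EXACT-w2g9.md`
§3); `--supports stmt-BirchSwinnertonDyer-20368` (helper, Theses-free). HONEST FRAMING: nothing here closes the crux or a registered stub; BSD is not
proved by any of this; no summit statement is proved by this seat. No definition, no named fact, no `sorry`. Sequel of files 9–11; with them the
(Hv̄-triv)/(Hv̄-move) decision — hence `#LK_{v̄} ∈ {1, 2}` exactly — is derived from (C3-loc) on EVERY S3c key: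
`#LK_{v̄} = 1` on (1,3), (0,7); `#LK_{v̄} = 2` on (1,7), (0,1), (0,3), (0,5) (memo §3 table, `e_{v̄}([d]₂)`).

WHAT. S3c frame, `W* = E[𝔮_r^∞]` pinned at `v` (kernel type (R) at `v̄`), `d = 2d'`, `d' ≡ 7 (8)`, (C3-loc). Since `−d' ≡ 1 (8)`, `√(−d') ∈ K_{v̄}` (Hensel,
p662192) is fixed by `Γ_{K_{v̄}}`, so the sign of `g` on `ι√d = ±ι√(−2)·√(−d')` is its sign on `ι√(−2)`, i.e. `+1` iff `ε(g) ≡ 1, 3 (8)` (p665535). By (R),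
an inertia element acts on `W*[8]` as `s·ε ∈ {1·1, 1·3, −5, −7} ≡ {1, 3}` and a degree-one element as `s·ε·α⁻¹ ∈ {1, 3}·3 = {3, 1} (mod 8)`; the set of
`δ ∈ D_{v̄}` acting on a generator `g₈` of `W*[8]` by `1` or `3` is an open subgroup containing the inertia image and a degree-one element, hence all of
`D_{v̄}` (-w3's `exists_frobPow_generator_decomp`). So no `δ ∈ D_{v̄}` acts as `−1` on `W*`, (C3-loc) forces `ker κ' ⊓ D_{v̄}` to act trivially ((Hv̄-triv)),
and `LK_{v̄} = ⊥` (p664385 `natCard_localKer_vbar_eq_one_of_frame`):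
* `zmod_eight_inv_three` (`3⁻¹ = 3` in `ℤ/8`); **`natCard_localKer_vbar_eq_one_of_frame_of_kerC3_even_seven`**.
presearch: as files 9–11 — held ([Rubin1999] §3, [Agboola2007] §3, [SerreAbelianLadic1968] I §1.2); no fact filed. beyond-print theorem: no.

References: [Rubin1999] §3 Lemma 3.6 (ii), Cor. 3.17; [Agboola2007] §3 Prop. 3.2, §6; [SerreAbelianLadic1968] Ch. I §1.2.
-/

noncomputable section

open scoped Classical

set_option linter.dupNamespace false
set_option autoImplicit false

namespace Summit.BirchSwinnertonDyer.BirchSwinnertonDyer.Theorems.PrintCf2.RestrictedSelmerPair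

open NumberField IsDedekindDomain Field WeierstrassCurve
open Literature.NumberTheory.EllipticCurves Literature.NumberTheory.EllipticCurves.GreenbergSelmer
open Literature.NumberTheory.GaloisRepresentations
open Summit.BirchSwinnertonDyer.BirchSwinnertonDyer.Theorems.PrintCf2.AdditiveAtSeven
open Summit.BirchSwinnertonDyer.BirchSwinnertonDyer.Theorems.PrintCf2.CMPrimes
open scoped Pointwise

variable {K : Type} [Field K] [NumberField K]

/-- `3⁻¹ = 3` in `ℤ/8`. [folklore] -/
theorem zmod_eight_inv_three : ∀ t : ZMod (2 ^ 3), 3 * t = 1 → t = 3 := by decide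

/-- **(R-DYADIC) on the key (0,7) from (C3-loc): `#LK_{v̄} = 1`** (`d = 2d'`, `d' ≡ 7 (mod 8)`): every `δ ∈ D_{v̄}` acts on a generator of `W*[8]` by `1` or
`3` (inertia: `s·ε ≡ 1, 3`; degree one: `s·ε·α⁻¹ ≡ 1, 3 (mod 8)`, the sign `s` being that on `ι√(−2)` as `√(−d') ∈ K_{v̄}`; generation), so none acts as
`−1` on `W*`, (C3-loc) gives (Hv̄-triv), and `LK_{v̄} = ⊥`. [cite: Agboola2007, §3 Prop. 3.2] [cite: Rubin1999, §3 Lemma 3.6 (ii) and Cor. 3.17] -/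
theorem natCard_localKer_vbar_eq_one_of_frame_of_kerC3_even_seven {d : ℤ} (hd0 : d ≠ 0) (h2d : (2 : ℤ) ∣ d) (hd7 : (d / 2) % 8 = 7) (W : WeierstrassCurve ℚ) [W.IsElliptic]
    (C : VariableChange ℚ) (hC : C • W = cm7.quadraticTwist (d : ℚ)) (hK : IsImaginaryQuadratic K)
    (v vbar : HeightOneSpectrum (𝓞 K)) (hv : ((2 : ℕ) : 𝓞 K) ∈ v.asIdeal) (hvbar : ((2 : ℕ) : 𝓞 K) ∈ vbar.asIdeal)
    (hne : vbar ≠ v) (π : (W.baseChange K).endRing) (hrel : (π : AddMonoid.End (W.baseChange K).geomPoints) * π = π - 2)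
    {r : ℤ_[2]} (hr : r * r = r - 2)
    (hclause : ∀ τ ∈ GreenbergSelmer.inertia v, ∀ x : ↥((W.baseChange K).endEigenPrimaryTorsion 2 π r), τ • x = x ∨ τ • x = -x)
    (κ' : ZpExtension K 2)
    (hC3 : ∀ σ ∈ decomp vbar, σ ∈ κ'.kerSubgroup ↔
      ((∀ x : ↥((W.baseChange K).endEigenPrimaryTorsion 2 π r), σ • x = x) ∨
        (∀ x : ↥((W.baseChange K).endEigenPrimaryTorsion 2 π r), σ • x = -x))) :
    Nat.card (resOfLe ↥((W.baseChange K).endEigenPrimaryTorsion 2 π r)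
        (inf_le_inf_right (decomp vbar) (le_top : κ'.kerSubgroup ≤ ⊤))).ker = 1 := by
  haveI : Fact (Nat.Prime 2) := ⟨Nat.prime_two⟩
  have hj : W.j = -3375 := j_eq_of_smul_eq_cm7Twist hd0 W C hC
  obtain ⟨θ, hθ⟩ := exists_sq_eq_neg_seven_of_cmEndo_mem_endRing W K hj π hrel
  have hK2 : Module.finrank ℚ K = 2 := hK.1
  obtain ⟨-, -, -, -, -, -, hgen, -⟩ := endEigenPrimaryTorsion_two_structure W hj K hθ π hrel hr
  -- the kernel-type clause (R) at `v̄` for `E[𝔮_r^∞]`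
  obtain ⟨hcl', -⟩ := endEigenPrimaryTorsion_two_pinningClause_swap W K hj hK hθ π hrel hr hv hvbar hne hclause
  have hcl'' : ∀ τ ∈ GreenbergSelmer.inertia vbar, ∀ y ∈ (W.baseChange K).endEigenPrimaryTorsion 2 π (1 - r),
      τ • y = y ∨ τ • y = -y := fun τ hτ y hy ↦ by
    rcases hcl' τ hτ ⟨y, hy⟩ with h | h
    · exact Or.inl (congrArg Subtype.val h)
    · exact Or.inr (congrArg Subtype.val h)
  have h1r : (1 - r) * (1 - r) = (1 - r) - 2 := by linear_combination hr
  have hdQ : (d : ℚ) ≠ 0 := by exact_mod_cast hd0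
  obtain ⟨α, hα, -, hUR⟩ := endEigenPrimaryTorsion_two_localTypes_named_of_pinned W K hj hθ π hrel h1r hdQ C hC vbar hvbar
    (inertiaDeg_eq_one_of_ne_two K hK2 hvbar hv hne.symm) hcl''
  simp only [sub_sub_cancel] at hUR
  have HR := fun σ n hσ s hs ↦ (hUR σ n hσ s hs).2
  -- Step 1: `d = 2d'`, `−d' ≡ 1 (mod 8)`: `√(−d') ∈ K_{v̄}` is fixed by all of `Γ_{K_{v̄}}` (Hensel)
  obtain ⟨d', rfl⟩ := h2d
  have hm8 : (-d') % 8 = 1 := by omega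
  obtain ⟨sK, hsK⟩ := exists_sq_eq_adicCompletion_of_emod_eight K vbar hvbar hm8
  set B := WeierstrassCurve.geomSqrt ((-d' : ℤ) : K) with hB_def
  have hBfix : ∀ σ : absoluteGaloisGroup (vbar.adicCompletion K),
      absGaloisRestrict K (vbar.adicCompletion K) σ • B = ((1 : ℤ) : AlgebraicClosure K) * B := by
    intro σ
    rw [Int.cast_one, one_mul]
    refine absGaloisRestrict_smul_eq_of_mem_range K vbar σ ?_
    set ι := absClosureEmbedding K (vbar.adicCompletion K) with hι
    have hιB : (ι B) ^ 2 = (algebraMap (vbar.adicCompletion K) (AlgebraicClosure (vbar.adicCompletion K)) sK) ^ 2 := by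
      rw [← map_pow, hB_def, WeierstrassCurve.geomSqrt_sq, AlgHom.commutes, ← map_pow, hsK,
        ← IsScalarTower.algebraMap_apply K (vbar.adicCompletion K) (AlgebraicClosure (vbar.adicCompletion K))]
    rcases sq_eq_sq_iff_eq_or_eq_neg.mp hιB with h | h
    · exact ⟨sK, h.symm⟩
    · exact ⟨-sK, by rw [map_neg, h]⟩
  set X := absClosureEmbedding ℚ K (WeierstrassCurve.geomSqrt (-2 : ℚ)) with hX_def
  set A := absClosureEmbedding ℚ K (WeierstrassCurve.geomSqrt (((2 * d' : ℤ)) : ℚ)) with hA_def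
  have hXY : (X * B) ^ 2 = A ^ 2 := by
    rw [mul_pow, hX_def, hA_def, hB_def, ← map_pow, ← map_pow, WeierstrassCurve.geomSqrt_sq, WeierstrassCurve.geomSqrt_sq,
      WeierstrassCurve.geomSqrt_sq, AlgHom.commutes, AlgHom.commutes]
    simp only [map_intCast, map_neg, map_ofNat, map_mul, Int.cast_mul, Int.cast_ofNat, Int.cast_neg]
    ring
  -- Step 2: `α ≡ 3 ≡ α⁻¹ (mod 8)` and the membership test `toZModPow 3 z = 0 ⇒ z ∈ (8)`
  have hα8 : PadicInt.toZModPow 3 ((α : ℤ_[2]ˣ) : ℤ_[2]) = 3 := by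
    refine zmod_eight_unitRoot _ (PadicInt.toZModPow 3 ((α⁻¹ : ℤ_[2]ˣ) : ℤ_[2])) ?_ ?_
    · rw [← map_mul, ← Units.val_mul, mul_inv_cancel, Units.val_one, map_one]
    · have := congrArg (PadicInt.toZModPow 3) hα
      rwa [map_pow, map_sub, map_ofNat] at this
  have hαi : PadicInt.toZModPow 3 ((α⁻¹ : ℤ_[2]ˣ) : ℤ_[2]) = 3 := by
    refine zmod_eight_inv_three _ ?_
    rw [← hα8, ← map_mul, ← Units.val_mul, mul_inv_cancel, Units.val_one, map_one]
  have hmem8 : ∀ z : ℤ_[2], PadicInt.toZModPow 3 z = 0 → z ∈ (Ideal.span {(2 : ℤ_[2]) ^ 3} : Ideal ℤ_[2]) := by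
    intro z hz
    have h := (RingHom.mem_ker (f := PadicInt.toZModPow (p := 2) 3)).mpr hz
    rw [PadicInt.ker_toZModPow] at h
    simpa only [Nat.cast_ofNat] using h
  -- Step 3: a generator `g₈` of `W*[8]`; every element of degree `0` or `1` acts on it by `1` or `3`
  obtain ⟨g₈, hg₈, hord8, -⟩ := hgen 3
  have h8 : 2 ^ 3 • g₈ = 0 := by rw [← hord8]; exact addOrderOf_nsmul_eq_zero g₈
  have key : ∀ (σ : absoluteGaloisGroup (vbar.adicCompletion K)) (n : ℕ), IsFrobPow σ (n : ℤ) → (n = 0 ∨ n = 1) →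
      absGaloisRestrict K (vbar.adicCompletion K) σ • g₈ = g₈ ∨ absGaloisRestrict K (vbar.adicCompletion K) σ • g₈ = 3 • g₈ := by
    intro σ n hσ hn
    set u : ℤ_[2]ˣ := GaloisRep.cyclotomicCharacter K 2 (absGaloisRestrict K (vbar.adicCompletion K) σ) with hu
    have htu : IsUnit (PadicInt.toZModPow 3 (u : ℤ_[2])) := (Units.isUnit u).map _
    -- one leaf: sign `s`, multiplier `N ∈ {1, 3}`, congruence `N ≡ s·ε·α^{-n} (mod 8)`
    have leaf : ∀ s N : ℤ,
        ((absGaloisRestrict K (vbar.adicCompletion K) σ • A = A ∧ s = 1) ∨ (absGaloisRestrict K (vbar.adicCompletion K) σ • A = -A ∧ s = -1)) →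
        (N = 1 ∨ N = 3) → PadicInt.toZModPow 3 ((N : ℤ_[2]) - (s : ℤ_[2]) * ((u * (α⁻¹) ^ n : ℤ_[2]ˣ) : ℤ_[2])) = 0 →
        absGaloisRestrict K (vbar.adicCompletion K) σ • g₈ = g₈ ∨ absGaloisRestrict K (vbar.adicCompletion K) σ • g₈ = 3 • g₈ := by
      intro s N hs hN h0
      have hact := HR σ n hσ s (by rw [hA_def] at hs; exact_mod_cast hs) 3 g₈ hg₈ h8 N (hmem8 _ (by rw [hu] at h0; exact h0))
      rcases hN with rfl | rfl
      · left; rwa [one_zsmul] at hact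
      · right; rwa [show (3 : ℤ) = ((3 : ℕ) : ℤ) from rfl, natCast_zsmul] at hact
    -- the sign of `res σ` on `ι√d` is its sign on `ι√(−2)`
    have hXs := smul_geomSqrt_neg_two_eq_of_cyclotomicCharacter K (absGaloisRestrict K (vbar.adicCompletion K) σ)
    rw [← hu] at hXs
    have hplus : (PadicInt.toZModPow 3 (u : ℤ_[2]) = 1 ∨ PadicInt.toZModPow 3 (u : ℤ_[2]) = 3) →
        absGaloisRestrict K (vbar.adicCompletion K) σ • A = A := fun ht ↦ by
      have hX1 : absGaloisRestrict K (vbar.adicCompletion K) σ • X = ((1 : ℤ) : AlgebraicClosure K) * X := by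
        rw [Int.cast_one, one_mul]; exact hXs.1 ht
      have h := smul_eq_intCast_mul_of_sq_eq _ hXY hX1 (hBfix σ)
      rwa [show ((1 * 1 : ℤ) : AlgebraicClosure K) = 1 by norm_num, one_mul] at h
    have hminus : (PadicInt.toZModPow 3 (u : ℤ_[2]) = 5 ∨ PadicInt.toZModPow 3 (u : ℤ_[2]) = 7) →
        absGaloisRestrict K (vbar.adicCompletion K) σ • A = -A := fun ht ↦ by
      have hX1 : absGaloisRestrict K (vbar.adicCompletion K) σ • X = ((-1 : ℤ) : AlgebraicClosure K) * X := by
        rw [Int.cast_neg, Int.cast_one, neg_one_mul]; exact hXs.2 ht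
      have h := smul_eq_intCast_mul_of_sq_eq _ hXY hX1 (hBfix σ)
      rwa [show ((-1 * 1 : ℤ) : AlgebraicClosure K) = -1 by norm_num, neg_one_mul] at h
    -- the eight leaves `(n, ε mod 8)`
    have hval : ∀ s N : ℤ, PadicInt.toZModPow 3 ((N : ℤ_[2]) - (s : ℤ_[2]) * ((u * (α⁻¹) ^ n : ℤ_[2]ˣ) : ℤ_[2])) =
        (N : ZMod (2 ^ 3)) - (s : ZMod (2 ^ 3)) * (PadicInt.toZModPow 3 (u : ℤ_[2]) * 3 ^ n) := by
      intro s N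
      rw [map_sub, map_mul, map_intCast, map_intCast, Units.val_mul, Units.val_pow_eq_pow_val, map_mul, map_pow, hαi]
    rcases zmod_eight_unit_cases _ htu with ht | ht | ht | ht <;> rcases hn with rfl | rfl
    · exact leaf 1 1 (Or.inl ⟨hplus (Or.inl ht), rfl⟩) (Or.inl rfl) (by rw [hval, ht]; decide)
    · exact leaf 1 3 (Or.inl ⟨hplus (Or.inl ht), rfl⟩) (Or.inr rfl) (by rw [hval, ht]; decide)
    · exact leaf 1 3 (Or.inl ⟨hplus (Or.inr ht), rfl⟩) (Or.inr rfl) (by rw [hval, ht]; decide)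
    · exact leaf 1 1 (Or.inl ⟨hplus (Or.inr ht), rfl⟩) (Or.inl rfl) (by rw [hval, ht]; decide)
    · exact leaf (-1) 3 (Or.inr ⟨hminus (Or.inl ht), rfl⟩) (Or.inr rfl) (by rw [hval, ht]; decide)
    · exact leaf (-1) 1 (Or.inr ⟨hminus (Or.inl ht), rfl⟩) (Or.inl rfl) (by rw [hval, ht]; decide)
    · exact leaf (-1) 1 (Or.inr ⟨hminus (Or.inr ht), rfl⟩) (Or.inl rfl) (by rw [hval, ht]; decide)
    · exact leaf (-1) 3 (Or.inr ⟨hminus (Or.inr ht), rfl⟩) (Or.inr rfl) (by rw [hval, ht]; decide)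
  -- Step 4: the subgroup `U = {δ ∈ D_{v̄} : δ•g₈ ∈ {g₈, 3g₈}}` is open and contains the generators, hence is everything
  have h9 : (3 : ℕ) • (3 : ℕ) • g₈ = g₈ := by
    rw [← mul_nsmul, show (3 * 3 : ℕ) = 2 ^ 3 + 1 from rfl, add_nsmul, h8, one_nsmul, zero_add]
  let U : Subgroup ↥(GreenbergSelmer.decomp vbar) :=
    { carrier := {δ | (δ : absoluteGaloisGroup K) • g₈ = g₈ ∨ (δ : absoluteGaloisGroup K) • g₈ = 3 • g₈}
      one_mem' := Or.inl (by rw [Subgroup.coe_one, one_smul])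
      mul_mem' := fun {a b} ha hb ↦ by
        simp only [Set.mem_setOf_eq, Subgroup.coe_mul, mul_smul] at ha hb ⊢
        rcases hb with hb | hb <;> rw [hb]
        · exact ha
        · rw [smul_comm]
          rcases ha with ha | ha <;> rw [ha]
          · exact Or.inr rfl
          · exact Or.inl h9
      inv_mem' := fun {a} ha ↦ by
        simp only [Set.mem_setOf_eq, Subgroup.coe_inv] at ha ⊢
        rcases ha with ha | ha
        · left
          conv_lhs => rw [← ha]
          rw [inv_smul_smul]
        · right
          have h3 : (a : absoluteGaloisGroup K) • ((3 : ℕ) • g₈) = g₈ := by rw [smul_comm, ha, h9]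
          conv_lhs => rw [← h3]
          rw [inv_smul_smul] }
  obtain ⟨φ, hφ1, hF, hgenU⟩ := exists_frobPow_generator_decomp vbar (D := GreenbergSelmer.decomp vbar) le_rfl le_rfl
  let xm : ↥((W.baseChange K).endEigenPrimaryTorsion 2 π r) := ⟨g₈, hg₈⟩
  have hU : IsOpen (U : Set ↥(GreenbergSelmer.decomp vbar)) := by
    have hcont : Continuous fun g : ↥(GreenbergSelmer.decomp vbar) ↦ g • xm :=
      (continuous_smul_endEigenPrimaryTorsion (W.baseChange K) 2 π r xm).comp continuous_subtype_val
    have hst : IsOpen ((MulAction.stabilizer ↥(GreenbergSelmer.decomp vbar) xm : Subgroup _) : Set ↥(GreenbergSelmer.decomp vbar)) := by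
      have : ((MulAction.stabilizer ↥(GreenbergSelmer.decomp vbar) xm : Subgroup _) : Set ↥(GreenbergSelmer.decomp vbar)) =
          (fun g : ↥(GreenbergSelmer.decomp vbar) ↦ g • xm) ⁻¹' {xm} := by
        ext g; exact MulAction.mem_stabilizer_iff
      rw [this]
      exact hcont.isOpen_preimage _ (isOpen_discrete _)
    refine Subgroup.isOpen_mono (fun g hg ↦ ?_) hst
    rw [MulAction.mem_stabilizer_iff] at hg
    exact Or.inl (congrArg Subtype.val hg)
  have hIU : (GreenbergSelmer.inertia vbar).subgroupOf (GreenbergSelmer.decomp vbar) ≤ U := by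
    intro g hg
    rw [Subgroup.mem_subgroupOf] at hg
    obtain ⟨τ, hτI, hτg⟩ := Subgroup.mem_map.mp hg
    have hτ0 : IsFrobPow τ ((0 : ℕ) : ℤ) := by exact_mod_cast isFrobPow_zero_iff_mem_absInertia.mpr hτI
    change (g : absoluteGaloisGroup K) • g₈ = g₈ ∨ (g : absoluteGaloisGroup K) • g₈ = 3 • g₈
    rw [← hτg]
    exact key τ 0 hτ0 (Or.inl rfl)
  have hFU : (⟨absGaloisRestrict K (vbar.adicCompletion K) φ, hF⟩ : ↥(GreenbergSelmer.decomp vbar)) ∈ U := by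
    have hφ1' : IsFrobPow φ ((1 : ℕ) : ℤ) := by exact_mod_cast hφ1
    exact key φ 1 hφ1' (Or.inr rfl)
  have htop := hgenU U hU hIU hFU
  -- Step 5: no element of `ker κ' ⊓ D_{v̄}` acts as `−1`; (C3-loc) gives (Hv̄-triv)
  have h2g : 2 • g₈ ≠ 0 := fun h ↦ by
    have hdvd : addOrderOf g₈ ∣ 2 := addOrderOf_dvd_of_nsmul_eq_zero h
    rw [hord8] at hdvd
    exact absurd (Nat.le_of_dvd two_pos hdvd) (by norm_num)
  have h4g : 4 • g₈ ≠ 0 := fun h ↦ by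
    have hdvd : addOrderOf g₈ ∣ 4 := addOrderOf_dvd_of_nsmul_eq_zero h
    rw [hord8] at hdvd
    exact absurd (Nat.le_of_dvd (by norm_num) hdvd) (by norm_num)
  refine natCard_localKer_vbar_eq_one_of_frame hd0 W C hC hK v vbar hv hvbar hne π hrel hr κ' fun σ hσ x ↦ ?_
  rcases (hC3 σ hσ.2).mp hσ.1 with h | h
  · exact h x
  · exfalso
    have hneg := congrArg Subtype.val (h xm)
    change σ • g₈ = -g₈ at hneg
    have hσU : (⟨σ, hσ.2⟩ : ↥(GreenbergSelmer.decomp vbar)) ∈ U := htop ▸ Subgroup.mem_top _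
    change σ • g₈ = g₈ ∨ σ • g₈ = 3 • g₈ at hσU
    rcases hσU with h1 | h3
    · rw [h1] at hneg
      exact h2g (by rw [two_nsmul]; exact add_eq_zero_iff_eq_neg.mpr hneg)
    · rw [h3] at hneg
      exact h4g (by rw [show (4 : ℕ) = 3 + 1 from rfl, add_nsmul, one_nsmul, hneg, neg_add_cancel])

end Summit.BirchSwinnertonDyer.BirchSwinnertonDyer.Theorems.PrintCf2.RestrictedSelmerPair

end
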